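import Summits.Ventures.CertifiedManyBodySolver.Transport.PauliMarkovMatrixFourier
import Summits.Ventures.CertifiedManyBodySolver.Transport.PauliMarkovLetters
import HarnessLib

/-!
# Ventures/CertifiedManyBodySolver — Transport/PauliMarkovMatrix.lean

HONEST FRAMING: first certified bounds; not a superconductivity verdict; every number certified or labelled float.

**LEMMA PMP (matrix Pauli–Markov body; op-02, `HOME/op/PM-2D.md` §7.4), as a theorem.** Fix a
translation-invariant infinite-volume lattice fermion state `ω : InfVolFermionState d` (any `d`), a spin
`σ`, the opposite spin `τ ≠ σ`, and the two one-site letters `A₀(x) = c_{xσ}`, `A₁(x) = n_{xτ} c_{xσ}`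
(`Transport/PauliMarkovLetters.lean`). Their two-point matrix `G_ω(r)_{jl} = ω(A_j(0)† A_l(r))`
(`letterTwoPoint`; entries `ω(c†_{0σ} c_{rσ})`, `ω(c†_{0σ} n_{rτ} c_{rσ})`, `ω(c†_{0σ} n_{0τ} c_{rσ})`,
`ω(c†_{0σ} n_{0τ} n_{rτ} c_{rσ})` — op-02's `(γ, g, f)` body) satisfies, for every coefficient family
`Λ : ℤ^d → M₂(ℂ)` with finite support `S` (symbol `Λ̂(k) = Σ_{r∈S} e^{−ik·r} Λ_r`, `matrixSymbol`) and every
function `u` integrable on the torus box `(0,2π]^d` such that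

  `Re tr(Λ̂(k) M) ≤ u(k)` for all `k` in the box and all `M ∈ M₂(ℂ)` with `0 ⪯ M ⪯ C(ν)`,
  `C(ν) = [1 ν; ν ν]`, `ν = ω(n_{0τ})` (`pmpConst`, `PMPFeasible`, `spinDensity`),

the bound **`Σ_{r∈S} Re tr(Λ_r G_ω(r)) ≤ (2π)^{-d} ∫_{(0,2π]^d} u`**
(`InfVolFermionState.IsTranslationInvariant.pauliMarkovMatrix`). With `u(k) = σ_{C(ν)}(Λ̂(k))`,
`σ_C(Y) = sup{Re tr(Y M) : 0 ⪯ M ⪯ C}` — op-02's support function, evaluated by the certificate reader as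
`(μ₁)₊ + (μ₂)₊` from the generalised eigenvalues of `(C, Y)` — this is the PMP row inequality
`Σ_r tr(Λ_r^* M̂(r)) ≤ h(Λ)` of PM-2D.md §7.4 (up to the relabelling `r ↦ −r` for Hermitian symbols). The
scalar corner (LEMMA PM-ℤ^d = op-02's Lemma PM-2D for `d = 2`) and the operator/slack forms used by
certificates are in `Transport/PauliMarkovMatrixRows.lean`.

PROOF (finite-dimensional; no operator-valued Herglotz–Bochner, no matrix Fejér–Riesz). Smear the letters
over the box window `[0,W)^d` with the plane wave `e^{ik·x}` (`letterWave`). The Gram identity of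
`PauliMarkovLetters` (`{A_j(x), A_l(y)†} = δ_{xy} K_{jl}(x)`) and state positivity sandwich the Gram matrix
`M_W(k)_{jl} = W^{-d} ω(B_j† B_l)` as `0 ⪯ M_W(k) ⪯ C(ν)` (`posSemidef_gramMatrix`,
`posSemidef_pmpConst_sub_gramMatrix`); translation invariance identifies `M_W(k)` with the Fejér mean of
`G_ω` (`gramMatrix_eq_fejerMatrix`); the abstract Fejér/majorant theorem
`sum_re_trace_le_integral_of_fejerMatrix` (`Transport/PauliMarkovMatrixFourier.lean`) concludes.

No physical notion is defined (abbreviations `letterCorr`, `letterTwoPoint`, `spinDensity`, `letterWave`,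
`gramMatrix`, `pmpConst`, `PMPFeasible` only), no named fact, no sorry; axioms standard.

References: op-02 PM-2D.md §2, §4, §7.4–7.5; E. H. Lieb, R. Seiringer, *The Stability of Matter in Quantum
Mechanics* (CUP 2010) Thm. 3.2 (Pauli bound `0 ≤ γ ≤ 1`); O. Bratteli, D. W. Robinson, *OAQSM II* §5.2.2;
M. Bakonyi, H. J. Woerdeman, *Matrix Completions, Moments, and Sums of Hermitian Squares* (2011) §1.3.
-/

noncomputable section

namespace Summit.Ventures.CertifiedManyBodySolver.Transport

open Matrix Finset MeasureTheory
open Literature.Probability.LatticeModels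
open Literature.MathematicalPhysics.QuantumLattice HubbardWave0
open scoped ComplexOrder Real

variable {d : ℕ}

/-! ### §1. The two-point matrix `G_ω(r)_{jl} = ω(A_j(0)† A_l(r))` of an infinite-volume state -/

section TwoPoint

variable (ω : InfVolFermionState d) (σ τ : Fin 2)

/-- `G^{στ}_{jl}(x, y) = ω(A_j(x)† A_l(y))`, computed on the region `{x} ∪ {y}`. -/
def letterCorr (j l : Fin 2) (x y : Site d) : ℂ :=
  ω.corr (letterOp j x (Finset.mem_singleton_self x) σ τ)ᴴ (letterOp l y (Finset.mem_singleton_self y) σ τ)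

/-- `ω(A_j(x)† A_l(y))` may be computed in any region containing `x, y` (isotony). -/
theorem expect_letterOp_conjTranspose_mul (j l : Fin 2) {Λ : Finset (Site d)} {x y : Site d}
    (hx : x ∈ Λ) (hy : y ∈ Λ) :
    ω.expect Λ ((letterOp j x hx σ τ)ᴴ * letterOp l y hy σ τ) = letterCorr ω σ τ j l x y := by
  rw [letterCorr, ω.corr_eq_expect_of_subset (Finset.singleton_subset_iff.2 hx)
    (Finset.singleton_subset_iff.2 hy), fermionEmbed_conjTranspose, fermionEmbed_incl_letterOp,
    fermionEmbed_incl_letterOp]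

/-- A `corr` of `A_j(x)†` and `A_l(y)` living in two regions is `G_{jl}(x, y)`. -/
theorem corr_letterOp (j l : Fin 2) {Λ₁ Λ₂ : Finset (Site d)} {x y : Site d} (hx : x ∈ Λ₁) (hy : y ∈ Λ₂) :
    ω.corr (letterOp j x hx σ τ)ᴴ (letterOp l y hy σ τ) = letterCorr ω σ τ j l x y := by
  rw [InfVolFermionState.corr_eq, fermionEmbed_conjTranspose, fermionEmbed_incl_letterOp,
    fermionEmbed_incl_letterOp, expect_letterOp_conjTranspose_mul]

/-- **Translation covariance**: `G_{jl}(x + w, y + w) = G_{jl}(x, y)` for translation-invariant `ω`. -/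
theorem letterCorr_add (hω : ω.IsTranslationInvariant) (j l : Fin 2) (x y w : Site d) :
    letterCorr ω σ τ j l (x + w) (y + w) = letterCorr ω σ τ j l x y := by
  conv_rhs => rw [letterCorr, ← hω w, InfVolFermionState.shift_corr, fermionEmbed_conjTranspose,
    fermionEmbed_shiftEmb_letterOp, fermionEmbed_shiftEmb_letterOp, corr_letterOp]

/-- Difference form: `G_{jl}(x, y) = G_{jl}(0, y − x)`. -/
theorem letterCorr_eq_zero_sub (hω : ω.IsTranslationInvariant) (j l : Fin 2) (x y : Site d) :
    letterCorr ω σ τ j l x y = letterCorr ω σ τ j l 0 (y - x) := by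
  rw [← letterCorr_add ω σ τ hω j l x y (-x), add_neg_cancel, ← sub_eq_add_neg]

/-- Hermitian symmetry: `conj G_{jl}(x, y) = G_{lj}(y, x)`. -/
theorem star_letterCorr (j l : Fin 2) (x y : Site d) :
    star (letterCorr ω σ τ j l x y) = letterCorr ω σ τ l j y x := by
  have hx : x ∈ ({x, y} : Finset (Site d)) := Finset.mem_insert_self _ _
  have hy : y ∈ ({x, y} : Finset (Site d)) := Finset.mem_insert_of_mem (Finset.mem_singleton_self _)
  rw [← expect_letterOp_conjTranspose_mul ω σ τ j l hx hy, ← expect_letterOp_conjTranspose_mul ω σ τ l j hy hx,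
    ← InfVolFermionState.expect_conjTranspose, Matrix.conjTranspose_mul, Matrix.conjTranspose_conjTranspose]

/-- **The two-point matrix** `G_ω(r) ∈ M₂(ℂ)`, `G_ω(r)_{jl} = ω(A_j(0)† A_l(r))`:
`G₀₀ = ω(c†_{0σ} c_{rσ})`, `G₀₁ = ω(c†_{0σ} n_{rτ} c_{rσ})`, `G₁₀ = ω(c†_{0σ} n_{0τ} c_{rσ})`,
`G₁₁ = ω(c†_{0σ} n_{0τ} n_{rτ} c_{rσ})` (PM-2D.md §7.4: `γ, g, f`). -/
def letterTwoPoint (r : Site d) : Matrix (Fin 2) (Fin 2) ℂ := Matrix.of fun j l => letterCorr ω σ τ j l 0 r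

/-- Entries of `G_ω(r)`. -/
theorem letterTwoPoint_apply (r : Site d) (j l : Fin 2) : letterTwoPoint ω σ τ r j l = letterCorr ω σ τ j l 0 r :=
  rfl

/-- Entries of `G_ω(r)` as expectations in any region containing `0` and `r`:
`G_ω(r)_{jl} = ω(A_j(0)† A_l(r))`. -/
theorem letterTwoPoint_eq_expect (r : Site d) (j l : Fin 2) {Λ : Finset (Site d)} (h0 : (0 : Site d) ∈ Λ)
    (hr : r ∈ Λ) : letterTwoPoint ω σ τ r j l = ω.expect Λ ((letterOp j 0 h0 σ τ)ᴴ * letterOp l r hr σ τ) := by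
  rw [letterTwoPoint_apply, expect_letterOp_conjTranspose_mul]

/-- `G_ω(r)₀₀ = ω(c†_{0σ} c_{rσ})` is the two-point function. -/
theorem letterTwoPoint_zero_zero (r : Site d) : letterTwoPoint ω σ τ r 0 0 = ω.twoPoint σ 0 r := by
  rw [letterTwoPoint_eq_expect ω σ τ r 0 0 (Finset.mem_insert_self (0 : Site d) {r})
    (Finset.mem_insert_of_mem (Finset.mem_singleton_self r)), letterOp_zero, letterOp_zero,
    InfVolFermionState.expect_creation_mul_annihilation]

/-- **The spin-`τ` density** `ν = ω(n_{0τ})` (a real number; it lies in `[0, 1]`). -/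
def spinDensity : ℝ := (ω.twoPoint τ 0 0).re

/-- For translation-invariant `ω`: `ω(n_{xτ}) = ν` at every site (as a complex number). -/
theorem expect_nAt_eq_spinDensity (hω : ω.IsTranslationInvariant) {Λ : Finset (Site d)} {x : Site d}
    (hx : x ∈ Λ) : ω.expect Λ (nAt x hx τ) = (spinDensity ω τ : ℂ) := by
  rw [InfVolFermionState.expect_nAt_eq_twoPoint, hω.twoPoint_eq_zero_sub ω τ x x, sub_self, spinDensity]
  have him : (ω.twoPoint τ 0 0).im = 0 := by
    rw [← InfVolFermionState.expect_nAt_eq_twoPoint ω τ (Finset.mem_singleton_self (0 : Site d))]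
    exact ω.expect_im_eq_zero_of_isHermitian (nAt_conjTranspose _ _ _)
  exact Complex.ext (by simp) (by simp [him])

end TwoPoint

/-! ### §2. Plane-wave smeared letters and the Gram matrix `0 ⪯ M_W(k) ⪯ C(ν)` -/

section Gram

variable (ω : InfVolFermionState d) (σ τ : Fin 2)

/-- The plane-wave smeared letter over the box window: `B_j(k) = Σ_{x ∈ [0,W)^d} e^{ik·x} A_j(x)`. -/
def letterWave (W : ℕ) (k : Fin d → ℝ) (j : Fin 2) : FermionOp (boxRegion (d := d) W) :=
  ∑ x : Fin d → Fin W, boxChar (boxSite W x) k • letterOp j (boxSite W x) (boxSite_mem W x) σ τ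

/-- **The Gram matrix** `M_W(k)_{jl} = W^{-d} ω(B_j(k)† B_l(k))`. -/
def gramMatrix (W : ℕ) (k : Fin d → ℝ) : Matrix (Fin 2) (Fin 2) ℂ :=
  Matrix.of fun j l => ((W : ℂ) ^ d)⁻¹ *
    ω.expect (boxRegion W) ((letterWave σ τ W k j)ᴴ * letterWave σ τ W k l)

/-- **The constant matrix** `C(ν) = [1 ν; ν ν]` of PM-2D.md §7.4 (`M₁(k) + M₂(−k)ᵀ = C(ρ)`). -/
def pmpConst (ν : ℝ) : Matrix (Fin 2) (Fin 2) ℂ := !![1, (ν : ℂ); (ν : ℂ), (ν : ℂ)]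

/-- **The PMP body**: `0 ⪯ M ⪯ C(ν)`. -/
def PMPFeasible (ν : ℝ) (M : Matrix (Fin 2) (Fin 2) ℂ) : Prop := M.PosSemidef ∧ (pmpConst ν - M).PosSemidef

/-- `C(ν)` is Hermitian (real symmetric). -/
theorem pmpConst_isHermitian (ν : ℝ) : (pmpConst ν).IsHermitian := by
  refine Matrix.IsHermitian.ext fun j l => ?_
  fin_cases j <;> fin_cases l <;> simp [pmpConst]

/-- **Translation invariance identifies the Gram matrix with the Fejér mean of `G_ω`**:
`M_W(k) = W^{-d} Σ_{x,y ∈ [0,W)^d} e^{ik·(y−x)} G_ω(y − x)`. -/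
theorem gramMatrix_eq_fejerMatrix (hω : ω.IsTranslationInvariant) (W : ℕ) (k : Fin d → ℝ) :
    gramMatrix ω σ τ W k = fejerMatrix (letterTwoPoint ω σ τ) W k := by
  ext j l
  simp only [gramMatrix, Matrix.of_apply, fejerMatrix, Matrix.smul_apply, Matrix.sum_apply, letterTwoPoint_apply,
    smul_eq_mul]
  congr 1
  rw [letterWave, letterWave, Matrix.conjTranspose_sum, Finset.sum_mul, map_sum]
  refine Finset.sum_congr rfl fun x _ => ?_
  rw [Finset.mul_sum, map_sum]
  refine Finset.sum_congr rfl fun y _ => ?_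
  rw [Matrix.conjTranspose_smul, Matrix.smul_mul, Matrix.mul_smul, smul_smul, map_smul, smul_eq_mul,
    expect_letterOp_conjTranspose_mul, letterCorr_eq_zero_sub ω σ τ hω, star_boxChar_mul_boxChar]

/-- The Gram matrix is Hermitian (for every state). -/
theorem gramMatrix_isHermitian (W : ℕ) (k : Fin d → ℝ) : (gramMatrix ω σ τ W k).IsHermitian := by
  refine Matrix.IsHermitian.ext fun j l => ?_
  simp only [gramMatrix, Matrix.of_apply, star_mul', ← InfVolFermionState.expect_conjTranspose,
    Matrix.conjTranspose_mul, Matrix.conjTranspose_conjTranspose]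
  congr 1
  rw [Complex.star_def, map_inv₀, map_pow, Complex.conj_natCast]

/-- The test-vector smearing `B_v = Σ_j v_j B_j(k)` is a smeared letter with coefficients `e^{ik·x} v_j`. -/
theorem sum_smul_letterWave_eq_smearedLetter (W : ℕ) (k : Fin d → ℝ) (v : Fin 2 → ℂ) :
    ∑ j, v j • letterWave σ τ W k j =
      smearedLetter (boxSite W) (boxSite_mem W) σ τ (fun x j => boxChar (boxSite W x) k * v j) := by
  rw [smearedLetter, Fintype.sum_prod_type_right]
  refine Finset.sum_congr rfl fun j _ => ?_
  rw [letterWave, Finset.smul_sum]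
  refine Finset.sum_congr rfl fun x _ => ?_
  rw [smul_smul, mul_comm]

/-- **The quadratic form of the Gram matrix**: `v† M_W(k) v = W^{-d} ω(B_v† B_v)`, `B_v = Σ_j v_j B_j(k)`. -/
theorem star_dotProduct_gramMatrix_mulVec (W : ℕ) (k : Fin d → ℝ) (v : Fin 2 → ℂ) :
    star v ⬝ᵥ (gramMatrix ω σ τ W k *ᵥ v) = ((W : ℂ) ^ d)⁻¹ *
      ω.expect (boxRegion W) ((∑ j, v j • letterWave σ τ W k j)ᴴ * ∑ j, v j • letterWave σ τ W k j) := by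
  have hR : ω.expect (boxRegion W) ((∑ j, v j • letterWave σ τ W k j)ᴴ * ∑ j, v j • letterWave σ τ W k j) =
      ∑ j, ∑ l, star (v j) * v l * ω.expect (boxRegion W) ((letterWave σ τ W k j)ᴴ * letterWave σ τ W k l) := by
    rw [Matrix.conjTranspose_sum, Finset.sum_mul, map_sum]
    refine Finset.sum_congr rfl fun j _ => ?_
    rw [Finset.mul_sum, map_sum]
    refine Finset.sum_congr rfl fun l _ => ?_
    rw [Matrix.conjTranspose_smul, Matrix.smul_mul, Matrix.mul_smul, smul_smul, map_smul, smul_eq_mul]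
  rw [hR, Finset.mul_sum]
  simp only [dotProduct, Matrix.mulVec, gramMatrix, Matrix.of_apply, Pi.star_apply, Finset.mul_sum]
  refine Finset.sum_congr rfl fun j _ => Finset.sum_congr rfl fun l _ => ?_
  ring

/-- `W^{-d} ≥ 0` in `ℂ`. -/
theorem inv_pow_natCast_nonneg (W : ℕ) : (0 : ℂ) ≤ ((W : ℂ) ^ d)⁻¹ := by
  rw [show ((W : ℂ) ^ d)⁻¹ = ((((W : ℝ) ^ d)⁻¹ : ℝ) : ℂ) by push_cast; ring]
  exact Complex.zero_le_real.2 (by positivity)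

/-- **`0 ⪯ M_W(k)`** (state positivity `ω(B_v† B_v) ≥ 0`; every state, every `W`). -/
theorem posSemidef_gramMatrix (W : ℕ) (k : Fin d → ℝ) : (gramMatrix ω σ τ W k).PosSemidef := by
  refine Matrix.PosSemidef.of_dotProduct_mulVec_nonneg (gramMatrix_isHermitian ω σ τ W k) fun v => ?_
  rw [star_dotProduct_gramMatrix_mulVec]
  exact mul_nonneg (inv_pow_natCast_nonneg W) (ω.expect_nonneg _ _)

/-- The expectation of the anticommutator table is the constant matrix: `ω(K_{jl}(x)) = C(ν)_{jl}`
(translation-invariant `ω`). -/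
theorem expect_letterGram (hω : ω.IsTranslationInvariant) (j l : Fin 2) {Λ : Finset (Site d)} {x : Site d}
    (hx : x ∈ Λ) : ω.expect Λ (letterGram j l x hx τ) = pmpConst (spinDensity ω τ) j l := by
  unfold letterGram pmpConst
  fin_cases j <;> fin_cases l <;>
    simp [ω.expect_one, expect_nAt_eq_spinDensity ω τ hω hx]

/-- The quadratic form of `C(ν)` in the ordering produced by the Gram identity:
`Σ_{j,l} v_j v̄_l C_{jl} = v† C v` (`C` is real symmetric). -/
theorem sum_sum_mul_star_mul_pmpConst (ν : ℝ) (v : Fin 2 → ℂ) :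
    ∑ j : Fin 2, ∑ l : Fin 2, v j * star (v l) * pmpConst ν j l = star v ⬝ᵥ (pmpConst ν *ᵥ v) := by
  simp only [pmpConst, dotProduct, Matrix.mulVec, Fin.sum_univ_two, Pi.star_apply, Matrix.of_apply,
    Matrix.cons_val', Matrix.cons_val_zero, Matrix.cons_val_one, Matrix.empty_val', Matrix.cons_val_fin_one]
  ring

/-- **The Gram identity in the state**: `ω(B_v B_v†) + ω(B_v† B_v) = W^d · v† C(ν) v`
(translation-invariant `ω`, `σ ≠ τ`; uses `|e^{ik·x}| = 1` and `#[0,W)^d = W^d`). -/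
theorem expect_wave_mul_conjTranspose_add (hω : ω.IsTranslationInvariant) (hστ : σ ≠ τ)
    (W : ℕ) (k : Fin d → ℝ) (v : Fin 2 → ℂ) :
    ω.expect (boxRegion W) ((∑ j, v j • letterWave σ τ W k j) * (∑ j, v j • letterWave σ τ W k j)ᴴ) +
        ω.expect (boxRegion W) ((∑ j, v j • letterWave σ τ W k j)ᴴ * ∑ j, v j • letterWave σ τ W k j) =
      (W : ℂ) ^ d * star v ⬝ᵥ (pmpConst (spinDensity ω τ) *ᵥ v) := by
  rw [← map_add, sum_smul_letterWave_eq_smearedLetter,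
    smearedLetter_mul_conjTranspose_add hστ (boxSite_injective W) (boxSite_mem W)]
  simp only [map_sum, map_smul, smul_eq_mul, expect_letterGram ω τ hω]
  -- `|χ_x|² = 1`
  have hχ : ∀ (x : Fin d → Fin W) (j l : Fin 2),
      boxChar (boxSite W x) k * v j * star (boxChar (boxSite W x) k * v l) = v j * star (v l) := by
    intro x j l
    rw [star_mul', show boxChar (boxSite W x) k * v j * (star (boxChar (boxSite W x) k) * star (v l)) =
      (star (boxChar (boxSite W x) k) * boxChar (boxSite W x) k) * (v j * star (v l)) by ring,
      star_boxChar_mul_boxChar, sub_self, boxChar_zero, one_mul]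
  simp_rw [hχ, sum_sum_mul_star_mul_pmpConst]
  rw [Finset.sum_const, Finset.card_univ, Fintype.card_fun, Fintype.card_fin, Fintype.card_fin, nsmul_eq_mul]
  push_cast
  ring

/-- **`M_W(k) ⪯ C(ν)`** (`W ≥ 1`, translation-invariant `ω`, `σ ≠ τ`): the CAR Gram identity and state
positivity `ω(B_v B_v†) ≥ 0`. -/
theorem posSemidef_pmpConst_sub_gramMatrix (hω : ω.IsTranslationInvariant) (hστ : σ ≠ τ)
    {W : ℕ} (hW : 0 < W) (k : Fin d → ℝ) :
    (pmpConst (spinDensity ω τ) - gramMatrix ω σ τ W k).PosSemidef := by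
  refine Matrix.PosSemidef.of_dotProduct_mulVec_nonneg
    ((pmpConst_isHermitian _).sub (gramMatrix_isHermitian ω σ τ W k)) fun v => ?_
  rw [Matrix.sub_mulVec, dotProduct_sub, star_dotProduct_gramMatrix_mulVec]
  have hid := expect_wave_mul_conjTranspose_add ω σ τ hω hστ W k v
  set B := ∑ j, v j • letterWave σ τ W k j with hB
  have hWd : ((W : ℂ) ^ d) ≠ 0 := pow_ne_zero _ (by exact_mod_cast hW.ne')
  -- `v† C v = W^{-d} (ω(B B†) + ω(B† B))`
  have hC : star v ⬝ᵥ (pmpConst (spinDensity ω τ) *ᵥ v) =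
      ((W : ℂ) ^ d)⁻¹ * (ω.expect (boxRegion W) (B * Bᴴ) + ω.expect (boxRegion W) (Bᴴ * B)) := by
    rw [hid, ← mul_assoc, inv_mul_cancel₀ hWd, one_mul]
  rw [hC, mul_add, add_sub_cancel_right]
  have hpos : 0 ≤ ω.expect (boxRegion W) (B * Bᴴ) := by
    have := ω.expect_nonneg (boxRegion W) Bᴴ
    rwa [Matrix.conjTranspose_conjTranspose] at this
  exact mul_nonneg (inv_pow_natCast_nonneg W) hpos

end Gram

/-! ### §3. Lemma PMP -/

section Main

variable (ω : InfVolFermionState d) (σ τ : Fin 2)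

/-- **LEMMA PMP (matrix Pauli–Markov body, majorant form; PM-2D.md §7.4).** For a translation-invariant
infinite-volume lattice fermion state `ω`, spins `σ ≠ τ`, a finite coefficient family `Λ : S → M₂(ℂ)` and any
function `u` integrable on `(0,2π]^d` that dominates `Re tr(Λ̂(k) M)` on the body `0 ⪯ M ⪯ C(ν)`
(`ν = ω(n_{0τ})`): `Σ_{r∈S} Re tr(Λ_r G_ω(r)) ≤ (2π)^{-d} ∫_{(0,2π]^d} u`. -/
theorem _root_.Literature.MathematicalPhysics.QuantumLattice.InfVolFermionState.IsTranslationInvariant.pauliMarkovMatrix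
    (hω : ω.IsTranslationInvariant) (hστ : σ ≠ τ) (S : Finset (Site d))
    (Lam : Site d → Matrix (Fin 2) (Fin 2) ℂ) (u : (Fin d → ℝ) → ℝ) (hu : IntegrableOn u (torusBox d))
    (hmaj : ∀ k ∈ torusBox d, ∀ M : Matrix (Fin 2) (Fin 2) ℂ, PMPFeasible (spinDensity ω τ) M →
      ((matrixSymbol S Lam k * M).trace).re ≤ u k) :
    ∑ r ∈ S, ((Lam r * letterTwoPoint ω σ τ r).trace).re ≤ ((2 * π) ^ d)⁻¹ * ∫ k in torusBox d, u k :=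
  sum_re_trace_le_integral_of_fejerMatrix (letterTwoPoint ω σ τ) (PMPFeasible (spinDensity ω τ))
    (fun W hW k _ => by
      rw [← gramMatrix_eq_fejerMatrix ω σ τ hω]
      exact ⟨posSemidef_gramMatrix ω σ τ W k, posSemidef_pmpConst_sub_gramMatrix ω σ τ hω hστ hW k⟩)
    S Lam u hu hmaj

/-- The entries of a feasible `M` that the scalar corner uses: `M₀₀` is real with `0 ≤ M₀₀ ≤ 1`. -/
theorem PMPFeasible.apply_zero_zero {ν : ℝ} {M : Matrix (Fin 2) (Fin 2) ℂ} (h : PMPFeasible ν M) :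
    (M 0 0).im = 0 ∧ 0 ≤ (M 0 0).re ∧ (M 0 0).re ≤ 1 := by
  have h0 := Complex.nonneg_iff.1 (h.1.diag_nonneg (i := 0))
  have h1 := Complex.nonneg_iff.1 (h.2.diag_nonneg (i := 0))
  simp only [pmpConst, Matrix.sub_apply, Matrix.of_apply, Matrix.cons_val', Matrix.cons_val_zero,
    Matrix.empty_val', Matrix.cons_val_fin_one, Complex.sub_re, Complex.one_re] at h1
  exact ⟨h0.2.symm, h0.1, by linarith [h1.1]⟩

end Main

end Summit.Ventures.CertifiedManyBodySolver.Transport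

end
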